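import Literature.Computability.AlgebraicComplexity.BorderRankMatMulThreeKernel
import Literature.Computability.AlgebraicComplexity.BorderRankMatMulThreeEnumData
import HarnessLib

/-!
# Borel-fixed `(110)`-candidates of `⟨3,3,3⟩`: kernel run of the test procedure, part 1

Topic `Literature/Computability/AlgebraicComplexity`. The kernel evaluates the verdict
`MatMul3.Ker.verdictH` of `BorderRankMatMulThreeKernel.lean` (at most one free block, and for every
variant of the free diagonal the hinted test `(210)`/`(120)` has certified dimension `≤ 15`) on the
killed profiles `MatMul3.killedProfs[0 .. 40)` of `BorderRankMatMulThreeEnumData.lean`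
(`decide +kernel`, in sub-ranges sized to the default heartbeat budget; the twelve parts are
assembled in `BorderRankMatMulThreeVerdictRun.lean`). Soundness of the verdict is
`MatMul3.IsAdmissible.test_le_of_verdictH` (`BorderRankMatMulThreeVerdict.lean`).

## References

* A. Conner, A. Harper, J. M. Landsberg, *New lower bounds for matrix multiplication and `det₃`*,
  Forum Math. Pi 11 (2023) e17, arXiv:1911.07981 — §6. [ConnerHarperLandsberg2023]
-/

namespace Literature.Computability.AlgebraicComplexity

namespace BorderApolarity

namespace MatMul3

/-- Kernel run on the killed profiles of index `0 ≤ i < 10`. [cite: ConnerHarperLandsberg2023, §6] -/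
theorem verdictRun1_1 : ∀ i : ℕ, 0 ≤ i → i < 10 →
    Ker.verdictH (killedProfs.getD i ([], [])).1 (killedProfs.getD i ([], [])).2 = true := by
  decide +kernel

/-- Kernel run on the killed profiles of index `10 ≤ i < 18`. [cite: ConnerHarperLandsberg2023, §6] -/
theorem verdictRun1_2 : ∀ i : ℕ, 10 ≤ i → i < 18 →
    Ker.verdictH (killedProfs.getD i ([], [])).1 (killedProfs.getD i ([], [])).2 = true := by
  decide +kernel

/-- Kernel run on the killed profiles of index `18 ≤ i < 27`. [cite: ConnerHarperLandsberg2023, §6] -/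
theorem verdictRun1_3 : ∀ i : ℕ, 18 ≤ i → i < 27 →
    Ker.verdictH (killedProfs.getD i ([], [])).1 (killedProfs.getD i ([], [])).2 = true := by
  decide +kernel

/-- Kernel run on the killed profiles of index `27 ≤ i < 34`. [cite: ConnerHarperLandsberg2023, §6] -/
theorem verdictRun1_4 : ∀ i : ℕ, 27 ≤ i → i < 34 →
    Ker.verdictH (killedProfs.getD i ([], [])).1 (killedProfs.getD i ([], [])).2 = true := by
  decide +kernel

/-- Kernel run on the killed profiles of index `34 ≤ i < 40`. [cite: ConnerHarperLandsberg2023, §6] -/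
theorem verdictRun1_5 : ∀ i : ℕ, 34 ≤ i → i < 40 →
    Ker.verdictH (killedProfs.getD i ([], [])).1 (killedProfs.getD i ([], [])).2 = true := by
  decide +kernel

/-- **Kernel run, part 1**: the verdict holds for the killed profiles of index `0 ≤ i < 40`.
[cite: ConnerHarperLandsberg2023, §6] -/
theorem verdictRun1 (i : ℕ) (h₁ : 0 ≤ i) (h₂ : i < 40) :
    Ker.verdictH (killedProfs.getD i ([], [])).1 (killedProfs.getD i ([], [])).2 = true := by
  by_cases g1 : i < 10
  · exact verdictRun1_1 i (by omega) g1
  by_cases g2 : i < 18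
  · exact verdictRun1_2 i (by omega) g2
  by_cases g3 : i < 27
  · exact verdictRun1_3 i (by omega) g3
  by_cases g4 : i < 34
  · exact verdictRun1_4 i (by omega) g4
  exact verdictRun1_5 i (by omega) h₂

end MatMul3

end BorderApolarity

end Literature.Computability.AlgebraicComplexity
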